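import Literature.Computability.Cryptography.ZhandryOracle
import Literature.Computability.Cryptography.MaskedOracleLemma
import HarnessLib

/-!
# The Servedio–Gortler / Simon levels of the Thm. 7.6 oracle: contents, oracle, and the quantum leaf

Topic `Literature/Computability/Cryptography`; companion of `ZhandryOracle.lean` (the level ENCODING
`levelDomain`/`levelStrings`/`specLang` is shared) and of `MaskedOracleLemma.lean` / `MaskedPRP.lean`
(the masks). In the `P/poly`-oracle separation of Aaronson–Chen 2017, Thm. 7.6, the non-permutation
levels may be taken from the construction "independently proposed by … Servedio and Gortler"
([AaronsonChen2017] §1, pp. 9 and 11) instead of Zhandry's `PRF^mod`: a level carries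
`PRP^raw_k ∘ rep_s` for a hidden XOR mask `s = 1·t`, a function two-to-one with XOR mask `s`, which
SIMON'S ALGORITHM tells from a permutation (Servedio–Gortler 2004, §6: "by running this procedure
`O(n)` times a quantum algorithm can distinguish between Case 1 (`f` is a permutation) and Case 3
(`f` is invariant under some XOR mask) with high probability"), while classically the masked PRP is
pseudorandom (`MaskedPRP.maskedPRP_indist`).

**What this file adds.**

* `MaskContent` (`filler` = identity of `{0,1}ⁿ`, `prp k` = `PRP^raw_k`, `masked k t` =
  `PRP^raw_k ∘ rep_{1·t}`) with `isPerm`, `blockLen`, `fn`, `WellFormed`, and the oracle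
  `maskOracle F ℓ C` of a content assignment (union of the level blocks, as `zhandryOracle`).
* The predicate `SimonLevelMachine B` — Simon's algorithm as a `BQP^O` machine for the
  level encoding: a poly-time uniform Clifford+T family with oracle gates which, told the block
  length by the announcements of the level, accepts (probability `≥ 2/3`) when the level function is
  injective and rejects (probability `≤ 1/3`) when it is two-to-one with a nonzero XOR mask — the
  shape of `aaronsonChen2017_lem75_quantum` with Zhandry's period replaced by Simon's mask; a
  hypothesis of the assembly, not a vendored fact.

## Design notes

* Masks have head bit `1` (`s = 1·t`, `|t| + 1 = ℓ n`): nonzero, uniformly sampleable from `ℓ n − 1`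
  coins behind a leading `1`, and `rep_s` is then the head-bit representative (`MaskedOracleLemma`).
* The quantum leaf is stated for the two-to-one promise (Simon's and S–G's Case 2), which the masked
  levels satisfy (`masked_two_to_one` in the Barriers assembly); its discharge is the tree's Simon
  development (`QuantumComplexity/SimonSampler*.lean`, oracle-free for white-box functions) with the
  function register filled by XOR queries to the level's value strings instead of an in-circuit
  program.

## Sources

* [ServedioGortler2004] R. Servedio, S. Gortler, SIAM J. Comput. 33 (2004), §6 (p. 14: Simon's
  algorithm, Cases 1–3; Thm. 6.1) and §8.1 (permutation vs. masked pseudorandom functions), held,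
  read via `lit read doi:10.1137/s0097539704412910`.
* [Simon1997] D. R. Simon, *On the power of quantum computation*, SIAM J. Comput. 26 (1997), §3.1,
  Thm. 3.4 (cited through [ServedioGortler2004] and the tree's `SimonFourier.lean`).
* [AaronsonChen2017] arXiv:1612.05903, §1 (pp. 9, 11), Thm. 7.6 (p. 30).
-/

namespace Literature.Computability.Cryptography

open _root_.Computability Complexity

/-! ### Level contents: `PRP^raw_k`, `PRP^raw_k ∘ rep_{1·t}`, or the filler -/

/-- **What a level of the Servedio–Gortler variant of the oracle carries**: the raw pseudorandom
permutation under the key `k`, the MASKED permutation `PRP^raw_k ∘ rep_{1·t}` (two-to-one with XOR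
mask `1·t`), or the filler (identity of `{0,1}ⁿ`).
[cite: ServedioGortler2004, §8.1 ("a permutation or … invariant under XOR mask with `sᵢ`")] -/
inductive MaskContent : Type
  /-- The identity permutation of `{0,1}ⁿ` (an untreated level). -/
  | filler : MaskContent
  /-- `f_n = PRP^raw_k`. -/
  | prp (k : List Bool) : MaskContent
  /-- `f_n = PRP^raw_k ∘ rep_{1·t}`. -/
  | masked (k t : List Bool) : MaskContent

namespace MaskContent

/-- The world bit: `1` iff the level function is a permutation. [cite: ServedioGortler2004, §8.1 (the bit `yᵢ`)] -/
def isPerm : MaskContent → Bool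
  | filler => true
  | prp _ => true
  | masked _ _ => false

/-- The block length: `ℓ n` for the cryptographic contents, `n` for the filler. [folklore] -/
def blockLen (ℓ : ℕ → ℕ) (n : ℕ) : MaskContent → ℕ
  | filler => n
  | prp _ => ℓ n
  | masked _ _ => ℓ n

/-- The level function. [cite: ServedioGortler2004, §8.1] -/
def fn (F : FunctionEnsemble) (n : ℕ) : MaskContent → List Bool → List Bool
  | filler => id
  | prp k => F n k
  | masked k t => F n k ∘ repStr (true :: t)

/-- Well-formed contents: key of length `κ n`, mask tail of length `ℓ n − 1`. [folklore] -/
def WellFormed (κ ℓ : ℕ → ℕ) (n : ℕ) : MaskContent → Prop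
  | filler => True
  | prp k => k.length = κ n
  | masked k t => k.length = κ n ∧ t.length + 1 = ℓ n

/-- The filler is a permutation level. [folklore] -/
@[simp] theorem isPerm_filler : filler.isPerm = true := rfl
/-- `PRP^raw` levels are permutation levels. [folklore] -/
@[simp] theorem isPerm_prp (k : List Bool) : (prp k).isPerm = true := rfl
/-- Masked levels are not permutation levels. [folklore] -/
@[simp] theorem isPerm_masked (k t : List Bool) : (masked k t).isPerm = false := rfl
/-- Block length of the filler. [folklore] -/
@[simp] theorem blockLen_filler (ℓ : ℕ → ℕ) (n : ℕ) : filler.blockLen ℓ n = n := rfl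
/-- Block length of a `PRP^raw` level. [folklore] -/
@[simp] theorem blockLen_prp (ℓ : ℕ → ℕ) (n : ℕ) (k : List Bool) : (prp k).blockLen ℓ n = ℓ n := rfl
/-- Block length of a masked level. [folklore] -/
@[simp] theorem blockLen_masked (ℓ : ℕ → ℕ) (n : ℕ) (k t : List Bool) : (masked k t).blockLen ℓ n = ℓ n := rfl
/-- Function of the filler. [folklore] -/
@[simp] theorem fn_filler (F : FunctionEnsemble) (n : ℕ) : filler.fn F n = id := rfl
/-- Function of a `PRP^raw` level. [folklore] -/
@[simp] theorem fn_prp (F : FunctionEnsemble) (n : ℕ) (k : List Bool) : (prp k).fn F n = F n k := rfl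
/-- Function of a masked level. [folklore] -/
@[simp] theorem fn_masked (F : FunctionEnsemble) (n : ℕ) (k t : List Bool) :
    (masked k t).fn F n = F n k ∘ repStr (true :: t) := rfl
/-- The filler is well formed. [folklore] -/
@[simp] theorem wellFormed_filler (κ ℓ : ℕ → ℕ) (n : ℕ) : filler.WellFormed κ ℓ n := trivial
/-- Well-formedness of a `PRP^raw` level. [folklore] -/
@[simp] theorem wellFormed_prp_iff (κ ℓ : ℕ → ℕ) (n : ℕ) (k : List Bool) :
    (prp k).WellFormed κ ℓ n ↔ k.length = κ n := Iff.rfl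
/-- Well-formedness of a masked level. [folklore] -/
@[simp] theorem wellFormed_masked_iff (κ ℓ : ℕ → ℕ) (n : ℕ) (k t : List Bool) :
    (masked k t).WellFormed κ ℓ n ↔ k.length = κ n ∧ t.length + 1 = ℓ n := Iff.rfl

/-- The level block carried by a content at level `n`. [cite: AaronsonChen2017, Thm. 7.6 (proof, p. 30)] -/
def strings (F : FunctionEnsemble) (ℓ : ℕ → ℕ) (n : ℕ) (c : MaskContent) : Set (List Bool) :=
  levelStrings n (c.blockLen ℓ n) (c.fn F n)

end MaskContent

/-- **The oracle of a content assignment** of the Servedio–Gortler variant: the union of the level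
blocks. [cite: AaronsonChen2017, Thm. 7.6 (proof, p. 30)] -/
def maskOracle (F : FunctionEnsemble) (ℓ : ℕ → ℕ) (C : ℕ → MaskContent) : Language Bool :=
  {w | ∃ n, w ∈ (C n).strings F ℓ n}

/-- Unfolding lemma. [folklore] -/
theorem mem_maskOracle_iff (F : FunctionEnsemble) (ℓ : ℕ → ℕ) (C : ℕ → MaskContent) (w : List Bool) :
    w ∈ maskOracle F ℓ C ↔ ∃ n, w ∈ (C n).strings F ℓ n :=
  Iff.rfl

/-! ### The quantum leaf: Simon's algorithm on a level of the oracle -/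

/-- **Servedio–Gortler 2004, §6 (Simon's algorithm distinguishes permutations from XOR-masked
functions), as a `BQP^O` machine for the level encoding** — the Simon counterpart of
`aaronsonChen2017_lem75_quantum`. For every polynomial probe bound `B` there is a threshold `N₁` such
that for every `n₀ ≥ N₁` some poly-time uniform family `D` of Clifford+T circuits with oracle gates
(`QCircuitFamily.IsUniform`; acceptance = measuring wire `0`) satisfies: on inputs of length `< n₀` it
accepts with probability `≤ 1/3` (hard-wiring); on an input `x` of length `n ≥ n₀`, for every block
length `j ∈ [n, B n]`, every length-preserving `f` on `{0,1}^j` and every oracle language whose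
level-`n` block is `levelStrings n j f`: (i) if `f` is injective on `{0,1}^j` then `D` accepts with
probability `≥ 2/3` (Case 1: the Fourier samples are uniform and `O(j)` of them contain a basis of
`(ℤ/2)^j` with probability `1 − 2^{−Ω(j)}`); (ii) if `f` is two-to-one on `{0,1}^j` with a nonzero
XOR mask `s` (head bit `1`) — `f y = f y' ↔ y' ∈ {y, y ⊕ s}` — then `D` accepts with probability
`≤ 1/3` (Cases 2–3: every sample `y` has `y · s = 0`, so the samples never contain a basis). Stated as
a predicate on the probe bound `B` and consumed as the HYPOTHESIS of the Simon assembly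
(`Literature/Barriers/QuantumAdvantage/PPolyOraclesThm76Simon.lean`); its proof is Simon's
"Fourier-twice" with the function register written by XOR queries to the value strings
`qryStr n y i` and the in-circuit rank test, i.e. the tree's `QuantumComplexity/SimonSampler*.lean`
with oracle gates in place of the white-box program.
[cite: ServedioGortler2004, §6 (p. 14, Cases 1–3; Thm. 6.1 (i))] [cite: Simon1997, §3.1 and Thm. 3.4] [cite: AaronsonChen2017, §1 (p. 9) and Thm. 7.6 (proof, p. 30: "hardwire")] -/
def SimonLevelMachine (B : Polynomial ℕ) : Prop :=
  ∃ N₁ : ℕ, ∀ n₀ : ℕ, N₁ ≤ n₀ →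
    ∃ D : QCircuitFamily cliffordT, D.IsUniform ∧
      (∀ (O : Language Bool) (x : List Bool), x.length < n₀ → D.acceptProbOn O x ≤ 1 / 3) ∧
      ∀ (O : Language Bool) (x : List Bool), n₀ ≤ x.length →
        ∀ (j : ℕ) (f : List Bool → List Bool), x.length ≤ j → j ≤ B.eval x.length →
          (∀ y : List Bool, y.length = j → (f y).length = j) →
          (∀ w ∈ levelDomain x.length, w ∈ O ↔ w ∈ levelStrings x.length j f) →
            (Set.InjOn f {y : List Bool | y.length = j} → 2 / 3 ≤ D.acceptProbOn O x) ∧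
            ((∃ s : List Bool, s.length = j ∧ s.head? = some true ∧
                ∀ y y' : List Bool, y.length = j → y'.length = j →
                  (f y = f y' ↔ y' = y ∨ y' = xorStr y s)) →
              D.acceptProbOn O x ≤ 1 / 3)

end Literature.Computability.Cryptography
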